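import Summits.CriticalPhenomena.PercolationContinuityZ3.Theorems.FK.Transplant.KNFreeCorridor
import Summits.CriticalPhenomena.PercolationContinuityZ3.Theorems.FK.Transplant.FreeBoundaryHypothesesKN
import Summits.CriticalPhenomena.PercolationContinuityZ3.Theorems.FK.Transplant.KNFreeLawSupport
import Summits.CriticalPhenomena.PercolationContinuityZ3.Theorems.FK.Transplant.KNFreePinning
import HarnessLib

/-!
# FK transplant, row FT-04 (4/4): rows 3–4 of the record — KN Lemmas 11–12 for `fkLaw`

**Framing.** The transplant theorem of record of this sub-cell
(`ufsc0_of_freeBoundaryHypothesis_r0`, `Transplant/FreeBoundaryTransplant.lean`) is CONDITIONAL on the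
free-boundary hypothesis FH (open at the same `p` for `q > 1`; over `p > p_c(q)` it is GRC Conj. (5.103) /
Duminil-Copin–Tassion Q5 territory, calibration K1; barrier note
`Literature.Barriers.CriticalPhenomena.SamePFreeBoundaryCriteria`); it is a typed reduction, not a proof
of continuity of the FK transition. Builds on p205010 (kernel theorem, internal audit signed; external
expert review pending). Cell `bschramm/fk-continuity`, FRONTIER TRANSPLANT, registry row FT-04, writer
fkt-p2; `--supports stmt-CriticalPhenomena-4575 --as helper`.

This file DISCHARGES two PROVE binders of the record for `1 ≤ q`, by instantiating the law-abstract
Lemmas 11–12 (`KNFreeElongated.lean`, `KNFreeCorridor.lean`) at the law family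
`μ Λ W := fkLaw Λ W q` of the cell (`Transplant/FreeBoundaryHypotheses.lean`):

* `knFreeElongatedHittable_of_one_le : 1 ≤ q → KNFreeElongatedHittable d q p` (row 3, KN Lemma 11);
* `knFreeCorridorRestr_of_one_le : 1 ≤ q → KNFreeCorridorRestr d q p` (row 4, KN Lemma 12).

Both remain implications FROM the row-2 binder `KNFreeTargetHittable d q p` (KN Lemma 10 for `fkLaw`,
open for `q > 1`) and `FH d q p`, exactly as typed in `Transplant/FreeBoundaryHypothesesKN.lean`; nothing
about FH is proved here. The structural hypotheses of the law-abstract files are verified for `fkLaw`: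
`lawMono_fkLaw` and `lawExt_fkLaw` are one-line instances of fkt-p3's `fkLaw_real_mono_weights'` (Grimmett
2006 (3.22)) and `fkLaw_eq_of_subset` (Λ-independence beyond the support) of `KNFreeLawSupport.lean`;
`lawNull_fkLaw` / `lawOne_fkLaw` (weight-`0` pairs closed, weight-`1` pairs open a.s.) follow from Grimmett
Thm. (3.7) in the form `rcMeasureW_condWeights_cylinder_compl` of `KNFreePinning.lean`; finiteness is
`isProbabilityMeasure_fkLaw` (`KNFreeLawSupport.lean`); and the two interfaces are identified definitionally:
`isHittableLaw_fkLaw_iff` (`IsHittableLaw (fkLaw··q) p g ↔ IsHittableFK q p g`),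
`targetPropertyLaw_fkLaw_iff` (`TargetPropertyLaw (fkLaw··q) p ↔ KNFreeTargetHittable d q p`).

## References

* G. Kozma, S. Nitzan, arXiv:2401.12397 (2024), §4 Lemma 11 (pp. 22–23), Lemma 12 (pp. 23–25). [KozmaNitzan2024]
* G. Grimmett, *The Random-Cluster Model*, Springer 2006: §1.4 eq. (1.20), Thm. (3.7), Thm. (3.21)/(3.22),
  Lemma (4.13). [Grimmett2006]
-/

noncomputable section

open MeasureTheory ProbabilityTheory
open scoped ENNReal

namespace Summit.CriticalPhenomena.PercolationContinuityZ3.Theorems.FK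

open Literature.Probability.Percolation Literature.Probability.LatticeModels SimpleGraph
open Literature.Probability.Percolation.KozmaNitzan

variable {d : ℕ}

/-! ## The structural hypotheses for `fkLaw` -/

section FkLaw

variable (q : ℝ)

/-- **`LawMono` for `fkLaw`** (Grimmett 2006, Thm. (3.21)/(3.22): raising the edge parameters raises
increasing events, `q ≥ 1`) — fkt-p3's `fkLaw_real_mono_weights'`. [cite: Grimmett2006, Thm. (3.21)] -/
theorem lawMono_fkLaw {q : ℝ} (hq : 1 ≤ q) : LawMono (d := d) (fun Λ W => fkLaw Λ W q) :=
  fun Λ _ _ hWW' _ hA hAm => fkLaw_real_mono_weights' Λ hWW' hq hA hAm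

/-- **`LawExt` for `fkLaw`** (Λ-independence beyond the support: the extra vertices of `Λ' ⊇ Λ` are
isolated under a weighting supported on the pairs of `Λ`; Grimmett 2006 Lemma (4.13)) — fkt-p3's
`fkLaw_eq_of_subset`. [cite: Grimmett2006, Lemma (4.13) (p. 71); §1.4 eq. (1.20)] -/
theorem lawExt_fkLaw {q : ℝ} (hq : 0 < q) : LawExt (d := d) (fun Λ W => fkLaw Λ W q) :=
  fun _ _ _ hW hΛ => (fkLaw_eq_of_subset hΛ hW hq).symm

/-- Weights as the conditional weights of themselves: `w = condWeights w F ξ` with `F` the pairs of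
parameter in `(0,1)` and `ξ` the pairs of parameter `1`. [cite: Grimmett2006, Thm. (3.7)] -/
private theorem condWeights_self {V : Type*} [Fintype V] (w : Sym2 V → unitInterval) :
    condWeights w {e | w e ≠ 0 ∧ w e ≠ 1} {e | w e = 1} = w := by
  funext e
  unfold condWeights
  by_cases h1 : w e = 1
  · have : ¬ (w e ≠ 0 ∧ w e ≠ 1) := fun h => h.2 h1
    rw [if_neg (show e ∉ {e : Sym2 V | w e ≠ 0 ∧ w e ≠ 1} from this),
      if_pos (show e ∈ {e : Sym2 V | w e = 1} from h1), h1]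
  · by_cases h0 : w e = 0
    · have : ¬ (w e ≠ 0 ∧ w e ≠ 1) := fun h => h.1 h0
      rw [if_neg (show e ∉ {e : Sym2 V | w e ≠ 0 ∧ w e ≠ 1} from this),
        if_neg (show e ∉ {e : Sym2 V | w e = 1} from h1), h0]
    · rw [if_pos (show e ∈ {e : Sym2 V | w e ≠ 0 ∧ w e ≠ 1} from ⟨h0, h1⟩)]

/-- Under `φ_{w,q}` (`0 < q`), almost surely every pair of parameter `1` is open and every pair of parameter
`0` is closed. [cite: Grimmett2006, Thm. (3.7), §1.4 eq. (1.20)] -/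
private theorem rcMeasureW_ae_pinned {V : Type*} [Fintype V] (w : Sym2 V → unitInterval) {q : ℝ}
    (hq : 0 < q) (B : Set V) :
    ∀ᵐ ω ∂(rcMeasureW w q B), ∀ e : Sym2 V, (w e = 1 → e ∈ ω) ∧ (w e = 0 → e ∉ ω) := by
  classical
  set F : Set (Sym2 V) := {e | w e ≠ 0 ∧ w e ≠ 1} with hF
  set ξ : Set (Sym2 V) := {e | w e = 1} with hξ
  have hdisj : Disjoint ξ F := by
    rw [Set.disjoint_left]
    intro e he hF'
    exact hF'.2 he
  have h0 : rcMeasureW w q B {ω : BondConfig V | ω \ F = ξ}ᶜ = 0 := by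
    have := rcMeasureW_condWeights_cylinder_compl w hq B hdisj
    rwa [condWeights_self] at this
  have hae : {ω : BondConfig V | ω \ F = ξ} ∈ ae (rcMeasureW w q B) := by
    rw [← compl_compl {ω : BondConfig V | ω \ F = ξ}]
    exact compl_mem_ae_iff.2 h0
  filter_upwards [hae] with ω hω e
  have hω' : ω \ F = ξ := hω
  constructor
  · intro h1
    have : e ∈ ω \ F := by rw [hω']; exact h1
    exact this.1
  · intro h0' heω
    have heF : e ∉ F := fun h => h.1 h0'
    have : e ∈ ω \ F := ⟨heω, heF⟩
    rw [hω'] at this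
    have h1 : w e = 1 := this
    rw [h0'] at h1
    exact zero_ne_one h1

/-- **`LawNull` for `fkLaw`**: pairs of weight `0` are almost surely closed. [cite: Grimmett2006, §1.4 eq. (1.20)] -/
theorem lawNull_fkLaw {q : ℝ} (hq : 0 < q) : LawNull (d := d) (fun Λ W => fkLaw Λ W q) := by
  intro Λ W
  show ∀ᵐ ω ∂(fkLaw Λ W q), ∀ e : Sym2 (Site d), W e = 0 → e ∉ ω
  have hmeas : MeasurableSet {ω : BondConfig (Site d) | ∀ e : Sym2 (Site d), W e = 0 → e ∉ ω} := by
    have : {ω : BondConfig (Site d) | ∀ e : Sym2 (Site d), W e = 0 → e ∉ ω} =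
        ⋂ e ∈ {e : Sym2 (Site d) | W e = 0}, {ω | e ∉ ω} := by
      ext ω; simp
    rw [this]
    exact MeasurableSet.biInter (Set.to_countable _) fun e _ => measurableSet_notMem e
  unfold fkLaw
  rw [ae_map_iff (measurable_of_finite (liftEdges Λ)).aemeasurable hmeas]
  filter_upwards [rcMeasureW_ae_pinned (fun e : Sym2 ↥Λ => W (Sym2.map Subtype.val e)) hq (∅ : Set ↥Λ)] with ω hω e he heω
  obtain ⟨e', he', rfl⟩ := (mem_liftEdges_iff).1 heω
  exact (hω e').2 he he'

/-- **`LawOne` for `fkLaw`**: pairs of weight `1` inside the piece are almost surely open.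
[cite: Grimmett2006, §1.4 eq. (1.20)] -/
theorem lawOne_fkLaw {q : ℝ} (hq : 0 < q) : LawOne (d := d) (fun Λ W => fkLaw Λ W q) := by
  intro Λ W
  show ∀ᵐ ω ∂(fkLaw Λ W q), ∀ e ∈ wireSet (↑Λ : Set (Site d)), W e = 1 → e ∈ ω
  have hmeas : MeasurableSet
      {ω : BondConfig (Site d) | ∀ e ∈ wireSet (↑Λ : Set (Site d)), W e = 1 → e ∈ ω} := by
    have : {ω : BondConfig (Site d) | ∀ e ∈ wireSet (↑Λ : Set (Site d)), W e = 1 → e ∈ ω} =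
        ⋂ e ∈ {e : Sym2 (Site d) | e ∈ wireSet (↑Λ : Set (Site d)) ∧ W e = 1}, {ω | e ∈ ω} := by
      ext ω; simp
    rw [this]
    exact MeasurableSet.biInter (Set.to_countable _) fun e _ => measurableSet_mem e
  unfold fkLaw
  rw [ae_map_iff (measurable_of_finite (liftEdges Λ)).aemeasurable hmeas]
  filter_upwards [rcMeasureW_ae_pinned (fun e : Sym2 ↥Λ => W (Sym2.map Subtype.val e)) hq (∅ : Set ↥Λ)] with ω hω e he h1
  induction e using Sym2.ind with
  | h x y =>
    obtain ⟨hx, hy, -⟩ := mk_mem_wireSet_iff.1 he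
    have hmap : Sym2.map Subtype.val s((⟨x, hx⟩ : ↥Λ), (⟨y, hy⟩ : ↥Λ)) = s(x, y) := rfl
    have h1' : W (Sym2.map Subtype.val s((⟨x, hx⟩ : ↥Λ), (⟨y, hy⟩ : ↥Λ))) = 1 := by
      rw [hmap]; exact h1
    exact (mem_liftEdges_iff).2 ⟨_, (hω _).1 h1', hmap⟩

end FkLaw

/-! ## The interfaces, identified -/

/-- `lookW` of `KNFreeLawInterfaces.lean` is the cell's `hitW` (definitionally). [folklore] -/
theorem lookW_eq_hitW (p : unitInterval) (g : Geom d) (ℓ m : ℕ) (v : Site d) :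
    lookW p g ℓ m v = hitW p g ℓ m v := rfl

/-- FK-hittability of the law family `fkLaw · · q` is the cell's `IsHittableFK q`. [cite: KozmaNitzan2024, §4 p. 16] -/
theorem isHittableLaw_fkLaw_iff {q : ℝ} {p : unitInterval} {g : Geom d} :
    IsHittableLaw (fun Λ W => fkLaw Λ W q) p g ↔ IsHittableFK q p g :=
  ⟨fun h => ⟨h⟩, fun h => h.hit⟩

/-- The target property of the law family `fkLaw · · q` is the row-2 binder `KNFreeTargetHittable d q p`.
[cite: KozmaNitzan2024, §4 Lemma 10 (p. 17)] -/
theorem targetPropertyLaw_fkLaw_iff {q : ℝ} {p : unitInterval} :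
    TargetPropertyLaw (d := d) (fun Λ W => fkLaw Λ W q) p ↔ KNFreeTargetHittable d q p := by
  constructor
  · intro h ε hε
    obtain ⟨δ, hδ, hH⟩ := h hε
    refine ⟨δ, hδ, fun H hHit => ?_⟩
    obtain ⟨R, hR⟩ := hH H fun g hg => isHittableLaw_fkLaw_iff.2 (hHit g hg)
    exact ⟨R, hR⟩
  · intro h ε hε
    obtain ⟨δ, hδ, hH⟩ := h hε
    refine ⟨δ, hδ, fun H hHit => ?_⟩
    obtain ⟨R, hR⟩ := hH H fun g hg => isHittableLaw_fkLaw_iff.1 (hHit g hg)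
    exact ⟨R, hR⟩

/-! ## Rows 3 and 4 of the record -/

/-- **Row 3 (`h_elong`) discharged for `1 ≤ q`: KN Lemma 11 for `fkLaw`.** Assuming the FK target property
(row 2, open for `q > 1`) and `FH`, every elongated geometry of aspect `K ≥ 2` is FK-hittable — the
law-abstract `isHittableLaw_of_mem_elongList` at `μ := fkLaw · · q`. CONDITIONAL in the sense of the
record: this is an implication from `KNFreeTargetHittable` and `FH`, not a statement about FH.
[cite: KozmaNitzan2024, §4 Lemma 11 (pp. 22–23)] -/
theorem knFreeElongatedHittable_of_one_le [NeZero d] {q : ℝ} (hq : 1 ≤ q) (p : unitInterval) :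
    KNFreeElongatedHittable d q p := by
  intro hT hFH K hK g hg
  have hq0 : 0 < q := one_pos.trans_le hq
  have hqf : ∀ (a : Fin d) (τ : Fin d → ℤˣ), IsHittableLaw (fun Λ W => fkLaw Λ W q) p (qfGeom a τ) :=
    fun a τ => isHittableLaw_fkLaw_iff.2 (hFH _ (qfGeom_mem_qfList a τ))
  exact isHittableLaw_fkLaw_iff.1
    (isHittableLaw_of_mem_elongList (fun Λ W => fkLaw Λ W q) (lawMono_fkLaw hq) (lawExt_fkLaw hq0)
      (lawNull_fkLaw hq0) (lawOne_fkLaw hq0) (fun Λ W => by haveI := isProbabilityMeasure_fkLaw Λ W hq0; infer_instance) p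
      (targetPropertyLaw_fkLaw_iff.2 hT) hqf K hK g hg)

/-- **Row 4 (`h_corr`) discharged for `1 ≤ q`: KN Lemma 12 for `fkLaw`** in the restricted form
`FKCorridorRestrAt` (hypothesis under `fkLaw T.Sfin (restrW ↑T.Aset T.W) q`, conclusion under
`restrW ↑T.Uset T.W`), assuming the FK target property (row 2) and `FH` — the law-abstract
`corridorLemmaLaw` at `μ := fkLaw · · q`. [cite: KozmaNitzan2024, §4 Lemma 12 (pp. 23–25)] -/
theorem knFreeCorridorRestr_of_one_le [NeZero d] {q : ℝ} (hq : 1 ≤ q) (p : unitInterval) :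
    KNFreeCorridorRestr d q p := by
  intro hT hFH ε hε
  have hq0 : 0 < q := one_pos.trans_le hq
  have hqf : ∀ (a : Fin d) (τ : Fin d → ℤˣ), IsHittableLaw (fun Λ W => fkLaw Λ W q) p (qfGeom a τ) :=
    fun a τ => isHittableLaw_fkLaw_iff.2 (hFH _ (qfGeom_mem_qfList a τ))
  obtain ⟨δ, hδ, m, h⟩ := corridorLemmaLaw (fun Λ W => fkLaw Λ W q) (lawMono_fkLaw hq)
    (lawExt_fkLaw hq0) (lawNull_fkLaw hq0) (lawOne_fkLaw hq0) (fun Λ W => by haveI := isProbabilityMeasure_fkLaw Λ W hq0; infer_instance)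
    p (targetPropertyLaw_fkLaw_iff.2 hT) hqf hε
  exact ⟨δ, hδ, m, fun T hT' hm hA => h T hT' hm hA⟩

/-- Row 4 in KN's "inside `U`" form under the UNRESTRICTED weighting (the shape the port of KN Theorem 6,
Step IV p. 31 consumes): `1 - ε < (fkLaw T.Sfin T.W q).real (o ↔ Tn(3r) inside U)`.
[cite: KozmaNitzan2024, §4 Lemma 12 (pp. 23–25), p. 31] -/
theorem knFreeCorridor_in_of_one_le [NeZero d] {q : ℝ} (hq : 1 ≤ q) (p : unitInterval)
    (hT : KNFreeTargetHittable d q p) (hFH : FH d q p) {ε : ℝ} (hε : 0 < ε) :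
    ∃ δ : ℝ, 0 < δ ∧ ∃ m : ℕ, ∀ S : CData d, S.Hyp p → m ≤ S.r →
      1 - δ < (fkLaw S.Sfin (restrW (↑S.Aset : Set (Site d)) S.W) q).real
          (⋃ b ∈ Finset.Icc (S.c - ((3 * S.r : ℕ) : Site d)) (S.c + ((3 * S.r : ℕ) : Site d)),
            openConn S.o b) →
        1 - ε < (fkLaw S.Sfin S.W q).real (⋃ b ∈ S.Tn (3 * S.r), openConnIn (↑S.Uset : Set (Site d)) S.o b) := by
  have hq0 : 0 < q := one_pos.trans_le hq
  have hqf : ∀ (a : Fin d) (τ : Fin d → ℤˣ), IsHittableLaw (fun Λ W => fkLaw Λ W q) p (qfGeom a τ) :=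
    fun a τ => isHittableLaw_fkLaw_iff.2 (hFH _ (qfGeom_mem_qfList a τ))
  exact corridorLemmaLaw_in (fun Λ W => fkLaw Λ W q) (lawMono_fkLaw hq) (lawExt_fkLaw hq0)
    (lawNull_fkLaw hq0) (lawOne_fkLaw hq0) (fun Λ W => by haveI := isProbabilityMeasure_fkLaw Λ W hq0; infer_instance) p
    (targetPropertyLaw_fkLaw_iff.2 hT) hqf hε

end Summit.CriticalPhenomena.PercolationContinuityZ3.Theorems.FK

end
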